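import Literature.Analysis.FluidPDE.ClassicalSolution
import Literature.Analysis.FluidPDE.ClassicalSolutionCalculus
import Literature.Analysis.FluidPDE.SpaceTimeCalculus
import Literature.Analysis.FluidPDE.DriftHeatLocalClass
import HarnessLib

/-!
# Crux `MixingPayoff` (stmt-NavierStokesRegularity-1422), line `birth`, stub F1
# `stub_admissibleDriftHeatClass`: MIX-admissible scalars belong to the local drift–heat class

Support file (theorems only, `--supports stmt-NavierStokesRegularity-1422`) for the crux
`Summit.NavierStokesRegularity.NavierStokesRegularity.Theses.SelfMixingDichotomy.MixingPayoff` of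
route `SelfMixingDichotomy`.

On the window `S = [T - r², T - r²/2]`, `0 < r`, let the drift `u : ℝ → ℝ³ → ℝ³` be continuous on
`S × ℝ³` and bounded by `A` on `S × U`, and let the scalar `θ` be jointly smooth on `S × ℝ³`
(`IsSmoothSpaceTimeOn S θ`) and solve `∂ₜθ + ⟪u, ∇θ⟫ = Δθ` pointwise on `S × ℝ³`, with the
one-sided time derivative `timeDerivWithin S`. Then `θ` is a member of the tree's local
time-integrated class `IsDriftHeatSolutionOn a θ A S U`
(`Literature/Analysis/FluidPDE/DriftHeatLocalClass`) for the **time-clamped drift**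
`a t x = u (max (T - r²) (min t (T - r²/2))) x`, which agrees with `u` on `S` and is continuous on
all of `ℝ × ℝ³`, hence Borel measurable:

* slices `θ t`, `t ∈ S`, are `C^∞` (`IsSmoothSpaceTimeOn.contDiff_slice`), so `C²` on `U`;
* `(t, x) ↦ D(θ t)(x)` and `(t, x) ↦ Δ(θ t)(x)` are continuous on `S × ℝ³`
  (`IsSmoothSpaceTimeOn.continuousOn_fderiv_slice`, `IsSmoothSpaceTimeOn.laplacian`, using
  `UniqueDiffOn ℝ S` from `T - r² < T - r²/2`);
* the time-integrated equation `θ t x − θ s x = ∫ₛᵗ (Δ(θ τ)(x) − D(θ τ)(x)[a τ x]) dτ` is the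
  fundamental theorem of calculus for the time line `τ ↦ θ τ x`, whose derivative within `S` is
  `timeDerivWithin S θ τ x = Δ(θ τ)(x) − ⟪u τ x, ∇(θ τ)(x)⟫ = Δ(θ τ)(x) − D(θ τ)(x)[u τ x]`
  (Riesz: `⟪v, ∇g(x)⟫ = Dg(x) v`, Mathlib `InnerProductSpace.toDual_symm_apply`).

The main theorem `stub_admissibleDriftHeatClass` is VERBATIM the registered stub signature of the
line skeleton (`Cruxes/MixingPayoff/Lines/birth.lean`, same local notation `E3 = EuclideanSpace ℝ
(Fin 3)`); the general-window form is `isDriftHeatSolutionOn_clamp_of_admissible`.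
-/

noncomputable section

open Literature.Analysis.FluidPDE MeasureTheory Set Function Metric
open scoped ContDiff

-- `Summit = Problem` for this summit; the tree lakefile sets `weak.linter.dupNamespace = false`.
set_option linter.dupNamespace false

namespace Summit.NavierStokesRegularity.NavierStokesRegularity.Theorems

-- the notation of the registered line skeleton, so that the stub header below is verbatim
local notation "E3" => EuclideanSpace ℝ (Fin 3)

/-- Riesz representation of the derivative of a real function: `⟪v, ∇g(x)⟫ = Dg(x) v`
(Mathlib `gradient`, `InnerProductSpace.toDual_symm_apply`). -/
theorem mixingPayoff_inner_gradient_eq_fderiv_apply (g : E3 → ℝ) (x v : E3) :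
    inner ℝ v (gradient g x) = fderiv ℝ g x v := by
  rw [gradient, real_inner_comm, InnerProductSpace.toDual_symm_apply]

/-- The time clamp `t ↦ max lo (min t hi)` onto a window `[lo, hi]`, `lo < hi`, is continuous,
lands in `[lo, hi]`, and is the identity on `[lo, hi]`. -/
theorem mixingPayoff_clamp_spec {lo hi : ℝ} (hlt : lo < hi) :
    Continuous (fun t : ℝ => max lo (min t hi)) ∧ (∀ t : ℝ, max lo (min t hi) ∈ Icc lo hi) ∧
      ∀ t ∈ Icc lo hi, max lo (min t hi) = t :=
  ⟨continuous_const.max (continuous_id.min continuous_const),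
    fun t => ⟨le_max_left _ _, max_le hlt.le (min_le_right _ _)⟩,
    fun t ht => by rw [min_eq_left ht.2, max_eq_right ht.1]⟩

/-- **The class bridge on a general window.** Let `lo < hi`, `S = [lo, hi]`, let `u` be continuous
on `S × ℝ³` with `‖u t x‖ ≤ A` on `S × U`, and let `θ` be jointly smooth on `S × ℝ³` with
`timeDerivWithin S θ t x + ⟪u t x, ∇(θ t)(x)⟫ = Δ(θ t)(x)` on `S × ℝ³`. Then `θ` belongs to the
local drift–heat class `IsDriftHeatSolutionOn a θ A S U` for the time-clamped drift
`a t x = u (max lo (min t hi)) x` (continuous on `ℝ × ℝ³`, hence measurable; equal to `u` on `S`).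
The integral identity is the fundamental theorem of calculus on each time line
(Mathlib `intervalIntegral.integral_eq_sub_of_hasDerivAt_of_le`) for the one-sided derivative
`IsSmoothSpaceTimeOn.hasDerivWithinAt_timeDerivWithin`, two-sided at interior times. -/
theorem isDriftHeatSolutionOn_clamp_of_admissible {lo hi : ℝ} (hlt : lo < hi) {u : ℝ → E3 → E3}
    {θ : ℝ → E3 → ℝ} (hu : ContinuousOn (Function.uncurry u) (Icc lo hi ×ˢ univ))
    (hθ : IsSmoothSpaceTimeOn (Icc lo hi) θ)
    (heq : ∀ t ∈ Icc lo hi, ∀ x : E3,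
      timeDerivWithin (Icc lo hi) θ t x + inner ℝ (u t x) (gradient (θ t) x)
        = Laplacian.laplacian (θ t) x)
    {A : ℝ} {U : Set E3} (hA : ∀ t ∈ Icc lo hi, ∀ x ∈ U, ‖u t x‖ ≤ A) :
    IsDriftHeatSolutionOn (fun t x => u (max lo (min t hi)) x) θ A (Icc lo hi) U := by
  have hS : UniqueDiffOn ℝ (Icc lo hi) := uniqueDiffOn_Icc hlt
  obtain ⟨hclc, hclmem, hclid⟩ := mixingPayoff_clamp_spec hlt
  refine
    { measurable_drift := ?_
      norm_drift_le := ?_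
      contDiffOn := fun t ht => (contDiff_infty.1 (hθ.contDiff_slice ht) 2).contDiffOn
      continuousOn_fderiv :=
        (hθ.continuousOn_fderiv_slice hS).mono (prod_mono Subset.rfl (subset_univ _))
      continuousOn_laplacian :=
        (hθ.laplacian hS).continuousOn.mono (prod_mono Subset.rfl (subset_univ _))
      integral_eq := ?_ }
  · -- the clamped drift is continuous on `ℝ × ℝ³`, hence measurable
    have hcomp : (uncurry fun t x => u (max lo (min t hi)) x) =
        uncurry u ∘ fun p : ℝ × E3 => (max lo (min p.1 hi), p.2) := rfl
    rw [hcomp]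
    exact (hu.comp_continuous ((hclc.comp continuous_fst).prodMk continuous_snd)
      fun p => mk_mem_prod (hclmem p.1) (mem_univ _)).measurable
  · -- the drift bound: the clamp is the identity on the window
    intro t ht x hx
    show ‖u (max lo (min t hi)) x‖ ≤ A
    rw [hclid t ht]
    exact hA t ht x hx
  · -- the time-integrated equation: FTC on the time line `τ ↦ θ τ x`
    intro x hx s hs t ht hst
    have hsub : Icc s t ⊆ Icc lo hi := Icc_subset_Icc hs.1 ht.2
    -- on `[s, t]` the integrand is the one-sided time derivative
    have hcongr : EqOn
        (fun τ => Laplacian.laplacian (θ τ) x - fderiv ℝ (θ τ) x (u (max lo (min τ hi)) x))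
        (fun τ => timeDerivWithin (Icc lo hi) θ τ x) (uIcc s t) := by
      intro τ hτ
      rw [uIcc_of_le hst] at hτ
      have hτS : τ ∈ Icc lo hi := hsub hτ
      show Laplacian.laplacian (θ τ) x - fderiv ℝ (θ τ) x (u (max lo (min τ hi)) x) =
        timeDerivWithin (Icc lo hi) θ τ x
      rw [hclid τ hτS, ← heq τ hτS x, mixingPayoff_inner_gradient_eq_fderiv_apply]
      ring
    rw [intervalIntegral.integral_congr hcongr]
    -- continuity of the time line on `[s, t]`
    have hcont : ContinuousOn (fun τ => θ τ x) (Icc s t) :=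
      continuousOn_time_slice (F := uncurry θ) hθ.continuousOn (mem_univ x) hsub
    -- two-sided derivative at interior times
    have hderiv : ∀ τ ∈ Ioo s t,
        HasDerivAt (fun σ => θ σ x) (timeDerivWithin (Icc lo hi) θ τ x) τ := by
      intro τ hτ
      have h1 : lo < τ := hs.1.trans_lt hτ.1
      have h2 : τ < hi := hτ.2.trans_le ht.2
      exact (hθ.hasDerivWithinAt_timeDerivWithin hS ⟨h1.le, h2.le⟩ x).hasDerivAt
        (Icc_mem_nhds h1 h2)
    -- the time derivative is continuous on the time line, hence interval integrable
    have hint : IntervalIntegrable (fun τ => timeDerivWithin (Icc lo hi) θ τ x) volume s t := by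
      refine ContinuousOn.intervalIntegrable ?_
      rw [uIcc_of_le hst]
      exact continuousOn_time_slice
        (F := fun z : ℝ × E3 => timeDerivWithin (Icc lo hi) θ z.1 z.2)
        (hθ.continuousOn_timeDerivWithin hS) (mem_univ x) hsub
    exact (intervalIntegral.integral_eq_sub_of_hasDerivAt_of_le hst hcont hderiv hint).symm

/-- **Stub F1 — MIX-admissible scalars belong to the local drift–heat class.** Let
`S = [T - r², T - r²/2]`, `0 < r`, let the drift `u` be continuous on `S × ℝ³` and bounded by `A`
on `S × U`, and let `θ` be jointly smooth on `S × ℝ³` solving `∂ₜθ + ⟪u, ∇θ⟫ = Δθ` pointwise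
(time derivative within `S`). Then for SOME drift `a` — here `u` clamped in time to `S`, which is
globally continuous hence measurable — `θ` is a member of `IsDriftHeatSolutionOn a θ A S U`
(`Literature/Analysis/FluidPDE/DriftHeatLocalClass`): slices `C²` on `U`, `(t,x) ↦ D(θ t) x` and
`(t,x) ↦ Δ(θ t) x` continuous on `S × U`, and the time-integrated equation
`θ t x − θ s x = ∫ₛᵗ (Δ(θ τ) x − D(θ τ) x (a τ x)) dτ` (FTC for the one-sided derivative,
`⟪u, ∇θ⟫ = D θ (u)` by `InnerProductSpace.toDual_symm_apply`). Proof: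
`isDriftHeatSolutionOn_clamp_of_admissible` with `lo = T - r²`, `hi = T - r²/2`. -/
theorem stub_admissibleDriftHeatClass :
    ∀ (T r : ℝ) (u : ℝ → E3 → E3) (θ : ℝ → E3 → ℝ), 0 < r →
    ContinuousOn (Function.uncurry u) (Set.Icc (T - r ^ 2) (T - r ^ 2 / 2) ×ˢ Set.univ) →
    IsSmoothSpaceTimeOn (Set.Icc (T - r ^ 2) (T - r ^ 2 / 2)) θ →
    (∀ t ∈ Set.Icc (T - r ^ 2) (T - r ^ 2 / 2), ∀ x : E3,
      timeDerivWithin (Set.Icc (T - r ^ 2) (T - r ^ 2 / 2)) θ t x + inner ℝ (u t x) (gradient (θ t) x)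
        = Laplacian.laplacian (θ t) x) →
    ∀ (A : ℝ) (U : Set E3), (∀ t ∈ Set.Icc (T - r ^ 2) (T - r ^ 2 / 2), ∀ x ∈ U, ‖u t x‖ ≤ A) →
    ∃ a : ℝ → E3 → E3, IsDriftHeatSolutionOn a θ A (Set.Icc (T - r ^ 2) (T - r ^ 2 / 2)) U := by
  intro T r u θ hr hu hθ heq A U hA
  have hlt : T - r ^ 2 < T - r ^ 2 / 2 := by nlinarith
  exact ⟨_, isDriftHeatSolutionOn_clamp_of_admissible hlt hu hθ heq hA⟩

end Summit.NavierStokesRegularity.NavierStokesRegularity.Theorems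

end
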